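import Mathlib

/-!
# `SnSubsetDichotomy.HyperoctahedralThreshold`, line `refutation-local-symmetry` — `stub_richDescent`

The "rich sub-word" step of the lead's skeleton for line `refutation-local-symmetry` (crux
`stmt-MatrixMultiplication-10883`, registered stub `stub_richDescent`).

Setting: `μ 0, μ 1, μ 2` are fixed-point-free involutions of `Fin n`; `col : Fin (k + 2) → Fin 3`
is a cyclically reduced colour word (cyclically consecutive letters differ); a *closed walk reading*
`col` is `p : Fin (k + 2) → Fin n` with `μ (col i) (p i) = p (i + 1)` (indices in `Fin (k + 2)`,
wrapping around); it is *simple* when `p` is injective.  The statement: if a cyclically reduced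
word of length `ℓ = k + 2` has at least `ℓ ^ (2 log₂ ℓ) · (2 ℓ M + 2 ℓ² + 2)` closed walks, then
some cyclically reduced word of length `ℓ' = k' + 2 ≤ ℓ` has more than `ℓ' M + ℓ'²` SIMPLE closed
walks.

Proof (a direct dichotomy on minimal repetitions; no recursion is needed).
* `RichDescent.window_of_rep` (adapted from the sibling stub file `…StubExtract`,
  `Extract.window_of_rep`): transport a closed walk to the `ℕ`-indexed periodic sequence
  `R m = p ↑m`; a non-injective walk has a repetition, and a repetition `R a = R (a + d + 2)` of
  MINIMAL gap has pairwise distinct values on the window `[a, a + d + 2)` and is cyclically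
  non-backtracking, `col ↑(a + d + 1) ≠ col ↑a` (a gap `1` is excluded since the `μ c` are
  fixed-point-free; a backtrack would produce the smaller gap `d` by the involution property).
  Hence (`RichDescent.bad_mem`) every non-simple closed walk `p` restricts, on some window `(a, d)`
  with `a + d + 2 ≤ k + 2`, to a SIMPLE closed walk `i ↦ p ↑(a + i)` reading the cyclically reduced
  sub-word `i ↦ col ↑(a + i)` of length `d + 2`.
* `RichDescent.walk_ext`: a closed walk is determined by one of its values, so for a fixed window
  distinct walks restrict to distinct sub-walks (`RichDescent.window`).
* Dichotomy (`stub_richDescent`): either some window `(a, d)`, `d ≤ k`, carries more than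
  `(d + 2) M + (d + 2)²` simple closed sub-walks — done with `k' = d`; or each of the
  `(k + 2)(k + 1)` windows carries at most `(k + 2) M + (k + 2)²` of them, so at most
  `(k + 2)(k + 1)((k + 2) M + (k + 2)²)` walks of `W` are non-simple, and since
  `|W| ≥ (k + 2)² (2 (k + 2) M + 2 (k + 2)² + 2)` (`log₂ (k + 2) ≥ 1`) more than
  `(k + 2) M + (k + 2)²` walks of `W` are simple — done with `k' = k` (`RichDescent.count_good`).
-/

-- the tree's namespace `Summit.MatrixMultiplication.MatrixMultiplication.…` repeats a component
set_option linter.dupNamespace false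

namespace Summit.MatrixMultiplication.MatrixMultiplication.Theorems.HyperoctahedralThreshold

open Equiv Function

namespace RichDescent

-- adapted from `Extract.window_of_rep` in
-- `Summits/MatrixMultiplication/MatrixMultiplication/Theorems/SnSubsetDichotomyHyperoctahedralThresholdStubExtract.lean`
/-- **Minimal-gap window.**  For a sequence `R` without immediate repetitions, a colouring `C`
without immediate repetitions, the backtrack rule
`R a = R (a + d + 1) → C (a + d) = C a → R (a + 1) = R (a + d)`, and some repetition
`R a = R b` with `a < b ≤ hi`, there is a repetition `R a = R (a + d + 2)` with `a + d + 2 ≤ hi`,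
pairwise distinct values on `[a, a + d + 2)` and `C (a + d + 1) ≠ C a`. [folklore] -/
theorem window_of_rep {α β : Type*} (R : ℕ → α) (C : ℕ → β) (hi : ℕ)
    (hnl : ∀ i, R i ≠ R (i + 1)) (hnb : ∀ i, C i ≠ C (i + 1))
    (hback : ∀ a d, R a = R (a + d + 1) → C (a + d) = C a → R (a + 1) = R (a + d))
    (hrep : ∃ a b, a < b ∧ b ≤ hi ∧ R a = R b) :
    ∃ a d, a + d + 2 ≤ hi ∧ R a = R (a + d + 2) ∧
      (∀ i j, i < j → j < d + 2 → R (a + i) ≠ R (a + j)) ∧ C (a + d + 1) ≠ C a := by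
  classical
  have hex : ∃ g, 1 ≤ g ∧ ∃ a, a + g ≤ hi ∧ R a = R (a + g) := by
    obtain ⟨a, b, h2, h3, h4⟩ := hrep
    refine ⟨b - a, by omega, a, by omega, ?_⟩
    rwa [Nat.add_sub_cancel' h2.le]
  obtain ⟨hg1, a, hhi, hR⟩ := Nat.find_spec hex
  have hmin : ∀ g', g' < Nat.find hex → ¬ (1 ≤ g' ∧ ∃ a, a + g' ≤ hi ∧ R a = R (a + g')) :=
    fun g' h => Nat.find_min hex h
  have hg2 : 2 ≤ Nat.find hex := by
    by_contra h
    have h1 : Nat.find hex = 1 := by omega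
    rw [h1] at hR
    exact hnl a hR
  refine ⟨a, Nat.find hex - 2, by omega, ?_, ?_, ?_⟩
  · rwa [show a + (Nat.find hex - 2) + 2 = a + Nat.find hex by omega]
  · intro i j hij hj heq
    refine hmin (j - i) (by omega) ⟨by omega, a + i, by omega, ?_⟩
    rwa [show a + i + (j - i) = a + j by omega]
  · intro hc
    have hb : R (a + 1) = R (a + (Nat.find hex - 1)) := by
      refine hback a (Nat.find hex - 1) ?_ ?_
      · rwa [show a + (Nat.find hex - 1) + 1 = a + Nat.find hex by omega]
      · rwa [show a + (Nat.find hex - 1) = a + (Nat.find hex - 2) + 1 by omega]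
    rcases Nat.lt_or_ge (Nat.find hex) 4 with hg4 | hg4
    · rcases (show Nat.find hex = 2 ∨ Nat.find hex = 3 by omega) with h2 | h3
      · rw [show a + (Nat.find hex - 2) + 1 = a + 1 by omega] at hc
        exact hnb a hc.symm
      · rw [show a + (Nat.find hex - 1) = a + 1 + 1 by omega] at hb
        exact hnl (a + 1) hb
    · refine hmin (Nat.find hex - 2) (by omega) ⟨by omega, a + 1, by omega, ?_⟩
      rwa [show a + 1 + (Nat.find hex - 2) = a + (Nat.find hex - 1) by omega]

-- positions of a cyclic walk are read in `ℕ` through the (scoped) cast `ℕ → Fin (k + 2)`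
open Fin.NatCast

variable {n k : ℕ}

/-- **Determinism.**  Two closed walks reading the same colour word which agree at one position
are equal. [folklore] -/
theorem walk_ext (μ : Fin 3 → Perm (Fin n)) (col : Fin (k + 2) → Fin 3)
    (p q : Fin (k + 2) → Fin n) (hp : ∀ i, μ (col i) (p i) = p (i + 1))
    (hq : ∀ i, μ (col i) (q i) = q (i + 1)) (a : ℕ)
    (h : p ((a : ℕ) : Fin (k + 2)) = q ((a : ℕ) : Fin (k + 2))) : p = q := by
  have key : ∀ j : ℕ, p ((a + j : ℕ) : Fin (k + 2)) = q ((a + j : ℕ) : Fin (k + 2)) := by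
    intro j
    induction j with
    | zero => exact h
    | succ j ih => rw [← Nat.add_assoc, Nat.cast_succ, ← hp, ← hq, ih]
  funext i
  obtain ⟨j, hj⟩ : ∃ j : ℕ, ((a + j : ℕ) : Fin (k + 2)) = i :=
    ⟨(i - (a : Fin (k + 2))).val, by rw [Nat.cast_add, Fin.cast_val_eq_self, add_sub_cancel]⟩
  rw [← hj]
  exact key j

/-- **Minimal repetition of a non-simple closed walk.**  A non-injective closed walk `p` reading
the cyclically reduced word `col` (for fixed-point-free involutions `μ c`) has a window
`[a, a + d + 2] ⊆ [0, k + 2]` on which it closes up (`p ↑a = p ↑(a + d + 2)`), takes pairwise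
distinct values on `[a, a + d + 2)`, and whose colour sub-word is cyclically reduced
(`col ↑(a + d + 1) ≠ col ↑a`). [folklore] -/
theorem bad_mem (μ : Fin 3 → Perm (Fin n)) (hinv : ∀ c, μ c * μ c = 1)
    (hfpf : ∀ c v, μ c v ≠ v) (col : Fin (k + 2) → Fin 3) (hcol : ∀ i, col i ≠ col (i + 1))
    (p : Fin (k + 2) → Fin n) (hp : ∀ i, μ (col i) (p i) = p (i + 1)) (hbad : ¬ Injective p) :
    ∃ a d : ℕ, a + d + 2 ≤ k + 2 ∧
      col ((a + d + 1 : ℕ) : Fin (k + 2)) ≠ col ((a : ℕ) : Fin (k + 2)) ∧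
      p ((a : ℕ) : Fin (k + 2)) = p ((a + d + 2 : ℕ) : Fin (k + 2)) ∧
      Injective (fun i : Fin (d + 2) => p ((a + i.val : ℕ) : Fin (k + 2))) := by
  have hstep : ∀ m : ℕ, μ (col (m : Fin (k + 2))) (p (m : Fin (k + 2))) =
      p ((m + 1 : ℕ) : Fin (k + 2)) := fun m => by
    rw [Nat.cast_succ]
    exact hp _
  have hinv' : ∀ c v, μ c (μ c v) = v := fun c v => by
    rw [← Perm.mul_apply, hinv, Perm.one_apply]
  have hnl : ∀ i : ℕ, p (i : Fin (k + 2)) ≠ p ((i + 1 : ℕ) : Fin (k + 2)) :=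
    fun i h => hfpf _ _ ((hstep i).trans h.symm)
  have hnb : ∀ i : ℕ, col (i : Fin (k + 2)) ≠ col ((i + 1 : ℕ) : Fin (k + 2)) := fun i => by
    rw [Nat.cast_succ]
    exact hcol _
  have hback : ∀ a d : ℕ, p (a : Fin (k + 2)) = p ((a + d + 1 : ℕ) : Fin (k + 2)) →
      col ((a + d : ℕ) : Fin (k + 2)) = col (a : Fin (k + 2)) →
      p ((a + 1 : ℕ) : Fin (k + 2)) = p ((a + d : ℕ) : Fin (k + 2)) := by
    intro a d h1 h2
    rw [← hstep a, h1, ← hstep (a + d), h2, hinv']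
  have hrep : ∃ a b : ℕ, a < b ∧ b ≤ k + 2 ∧ p (a : Fin (k + 2)) = p (b : Fin (k + 2)) := by
    obtain ⟨i, j, hij, hne⟩ := Function.not_injective_iff.mp hbad
    rcases lt_or_gt_of_ne (Fin.val_ne_of_ne hne) with h | h
    · exact ⟨i.val, j.val, h, j.isLt.le, by simpa only [Fin.cast_val_eq_self] using hij⟩
    · exact ⟨j.val, i.val, h, i.isLt.le, by simpa only [Fin.cast_val_eq_self] using hij.symm⟩
  obtain ⟨a, d, hhi, hcl, hw, hcyc⟩ := window_of_rep (fun m : ℕ => p (m : Fin (k + 2)))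
    (fun m : ℕ => col (m : Fin (k + 2))) (k + 2) hnl hnb hback hrep
  refine ⟨a, d, hhi, hcyc, hcl, fun x y hxy => ?_⟩
  rcases lt_trichotomy x.val y.val with h | h | h
  · exact absurd hxy (hw _ _ h y.isLt)
  · exact Fin.ext h
  · exact absurd hxy.symm (hw _ _ h x.isLt)

/-- **The simple closed sub-walks over one window.**  For a window `(a, d)` there are: the colour
sub-word `col' i = col ↑(a + i)` of length `d + 2`, the finset `P` of restrictions
`i ↦ p ↑(a + i)` of the walks `p ∈ W` which close up simply over the window (when the sub-word is
cyclically reduced), and the finset `B` of those walks, with `|P| = |B|` (a closed walk is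
determined by one value), `col'` cyclically reduced as soon as `P` is nonempty, and every member
of `P` a simple closed walk reading `col'`. [folklore] -/
theorem window (μ : Fin 3 → Perm (Fin n)) (col : Fin (k + 2) → Fin 3)
    (hcol : ∀ i, col i ≠ col (i + 1)) (W : Finset (Fin (k + 2) → Fin n))
    (hW : ∀ p ∈ W, ∀ i, μ (col i) (p i) = p (i + 1)) (a d : ℕ) :
    ∃ (col' : Fin (d + 2) → Fin 3) (P : Finset (Fin (d + 2) → Fin n))
      (B : Finset (Fin (k + 2) → Fin n)),
      P.card = B.card ∧ (P.Nonempty → ∀ i, col' i ≠ col' (i + 1)) ∧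
      (∀ q ∈ P, Injective q ∧ ∀ i, μ (col' i) (q i) = q (i + 1)) ∧
      ∀ p ∈ W, col ((a + d + 1 : ℕ) : Fin (k + 2)) ≠ col ((a : ℕ) : Fin (k + 2)) →
        p ((a : ℕ) : Fin (k + 2)) = p ((a + d + 2 : ℕ) : Fin (k + 2)) →
        Injective (fun i : Fin (d + 2) => p ((a + i.val : ℕ) : Fin (k + 2))) → p ∈ B := by
  obtain ⟨B, hB⟩ : ∃ B : Finset (Fin (k + 2) → Fin n), ∀ p, p ∈ B ↔ p ∈ W ∧
      (col ((a + d + 1 : ℕ) : Fin (k + 2)) ≠ col ((a : ℕ) : Fin (k + 2)) ∧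
        p ((a : ℕ) : Fin (k + 2)) = p ((a + d + 2 : ℕ) : Fin (k + 2)) ∧
        Injective (fun i : Fin (d + 2) => p ((a + i.val : ℕ) : Fin (k + 2)))) :=
    ⟨_, fun p => Finset.mem_filter⟩
  refine ⟨fun i => col ((a + i.val : ℕ) : Fin (k + 2)),
    B.image (fun p (i : Fin (d + 2)) => p ((a + i.val : ℕ) : Fin (k + 2))), B, ?_, ?_, ?_,
    fun p hpW h1 h2 h3 => (hB p).mpr ⟨hpW, h1, h2, h3⟩⟩
  · -- distinct walks restrict to distinct sub-walks
    apply Finset.card_image_of_injOn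
    intro p hp q hq hpq
    have hpW : p ∈ W := ((hB p).mp (Finset.mem_coe.mp hp)).1
    have hqW : q ∈ W := ((hB q).mp (Finset.mem_coe.mp hq)).1
    refine walk_ext μ col p q (hW p hpW) (hW q hqW) a ?_
    have h0 := congrFun hpq 0
    simpa using h0
  · -- the sub-word is cyclically reduced
    rintro ⟨q, hq⟩ i
    obtain ⟨p, hp, -⟩ := Finset.mem_image.mp hq
    have hcyc := ((hB p).mp hp).2.1
    rcases Fin.eq_castSucc_or_eq_last i with ⟨j, rfl⟩ | rfl
    · simp only [Fin.coeSucc_eq_succ, Fin.val_castSucc, Fin.val_succ]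
      rw [← Nat.add_assoc, Nat.cast_succ]
      exact hcol _
    · simpa only [Fin.last_add_one, Fin.val_last, Fin.val_zero, Nat.add_zero, Nat.add_assoc]
        using hcyc
  · -- every member of `P` is a simple closed walk reading the sub-word
    intro q hq
    obtain ⟨p, hp, rfl⟩ := Finset.mem_image.mp hq
    obtain ⟨hpW, -, hcl, hinj⟩ := (hB p).mp hp
    refine ⟨hinj, fun i => ?_⟩
    dsimp only
    rw [hW p hpW, ← Nat.cast_add_one]
    rcases Fin.eq_castSucc_or_eq_last i with ⟨j, rfl⟩ | rfl
    · simp only [Fin.coeSucc_eq_succ, Fin.val_castSucc, Fin.val_succ, Nat.add_assoc]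
    · simp only [Fin.last_add_one, Fin.val_last, Fin.val_zero, Nat.add_zero]
      rw [show a + (d + 1) + 1 = a + d + 2 by omega]
      exact hcl.symm

/-- **The final count.**  If `|W| ≥ (k + 2)² (2 (k + 2) M + 2 (k + 2)² + 2)` and at most
`(k + 2)(k + 1)((k + 2) M + (k + 2)²)` walks of `W` are non-simple, then more than
`(k + 2) M + (k + 2)²` walks of `W` are simple. [folklore] -/
theorem count_good (k M N g b : ℕ)
    (h1 : (k + 2) ^ 2 * (2 * (k + 2) * M + 2 * (k + 2) ^ 2 + 2) ≤ N)
    (h2 : b ≤ (k + 2) * (k + 1) * ((k + 2) * M + (k + 2) ^ 2)) (h3 : g + b = N) :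
    (k + 2) * M + (k + 2) ^ 2 < g := by
  have e1 : (k + 2) ^ 2 * (2 * (k + 2) * M + 2 * (k + 2) ^ 2 + 2) =
      2 * ((k + 2) ^ 2 * ((k + 2) * M + (k + 2) ^ 2)) + 2 * (k + 2) ^ 2 := by ring
  have e2 : (k + 2) * (k + 1) * ((k + 2) * M + (k + 2) ^ 2) ≤
      (k + 2) ^ 2 * ((k + 2) * M + (k + 2) ^ 2) :=
    Nat.mul_le_mul_right _ (by rw [sq]; exact Nat.mul_le_mul_left _ (by omega))
  have e3 : (k + 2) * M + (k + 2) ^ 2 ≤ (k + 2) ^ 2 * ((k + 2) * M + (k + 2) ^ 2) :=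
    Nat.le_mul_of_pos_left _ (by positivity)
  have e4 : 1 ≤ (k + 2) ^ 2 := Nat.one_le_pow _ _ (by omega)
  rw [e1] at h1
  omega

end RichDescent

/-- **Rich words have sub-words with many simple closed walks** (stub `stub_richDescent` of line
`refutation-local-symmetry`): for three fixed-point-free involutions `μ 0, μ 1, μ 2` of `Fin n`, a
cyclically reduced colour word `col` of length `k + 2` with at least
`(k + 2) ^ (2 log₂ (k + 2)) · (2 (k + 2) M + 2 (k + 2)² + 2)` closed walks admits a cyclically
reduced word `col'` of length `k' + 2 ≤ k + 2` with more than `(k' + 2) M + (k' + 2)²` simple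
closed walks. [folklore] -/
theorem stub_richDescent : ∀ (n k M : ℕ) (μ : Fin 3 → Equiv.Perm (Fin n)), (∀ c, μ c * μ c = 1) → (∀ c v, μ c v ≠ v) → ∀ (col : Fin (k + 2) → Fin 3), (∀ i, col i ≠ col (i + 1)) → ∀ (W : Finset (Fin (k + 2) → Fin n)), (∀ p ∈ W, ∀ i, μ (col i) (p i) = p (i + 1)) → (k + 2) ^ (2 * Nat.log 2 (k + 2)) * (2 * (k + 2) * M + 2 * (k + 2) ^ 2 + 2) ≤ W.card → ∃ k' ≤ k, ∃ (col' : Fin (k' + 2) → Fin 3) (P : Finset (Fin (k' + 2) → Fin n)), (∀ i, col' i ≠ col' (i + 1)) ∧ (∀ p ∈ P, Function.Injective p ∧ ∀ i, μ (col' i) (p i) = p (i + 1)) ∧ (k' + 2) * M + (k' + 2) ^ 2 < P.card := by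
  intro n k M μ hinv hfpf col hcol W hW hrich
  choose col' P B hPB hne hP hB using fun a d => RichDescent.window μ col hcol W hW a d
  by_cases hbig : ∃ a d, d ≤ k ∧ (d + 2) * M + (d + 2) ^ 2 < (P a d).card
  · obtain ⟨a, d, hd, hcard⟩ := hbig
    exact ⟨d, hd, col' a d, P a d, hne a d (Finset.card_pos.mp (by omega)), hP a d, hcard⟩
  · refine ⟨k, le_rfl, col, W.filter fun p => Function.Injective p, hcol, ?_, ?_⟩
    · intro p hp
      obtain ⟨hpW, hinj⟩ := Finset.mem_filter.mp hp
      exact ⟨hinj, hW p hpW⟩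
    · -- every window carries few simple closed sub-walks
      have hsmall : ∀ a d, d ≤ k → (B a d).card ≤ (k + 2) * M + (k + 2) ^ 2 := by
        intro a d hd
        have h1 : (P a d).card ≤ (d + 2) * M + (d + 2) ^ 2 := by
          by_contra h
          exact hbig ⟨a, d, hd, not_le.mp h⟩
        have hd2 : d + 2 ≤ k + 2 := by omega
        calc (B a d).card = (P a d).card := (hPB a d).symm
          _ ≤ (d + 2) * M + (d + 2) ^ 2 := h1
          _ ≤ (k + 2) * M + (k + 2) ^ 2 :=
            Nat.add_le_add (Nat.mul_le_mul_right _ hd2) (Nat.pow_le_pow_left hd2 2)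
      -- hence few walks of `W` are non-simple
      have hbad : (W.filter fun p => ¬ Function.Injective p).card ≤
          (k + 2) * (k + 1) * ((k + 2) * M + (k + 2) ^ 2) := by
        calc (W.filter fun p => ¬ Function.Injective p).card
            ≤ ((Finset.range (k + 2) ×ˢ Finset.range (k + 1)).biUnion
                fun x => B x.1 x.2).card := by
              refine Finset.card_le_card fun p hp => ?_
              obtain ⟨hpW, hpbad⟩ := Finset.mem_filter.mp hp
              obtain ⟨a, d, had, h1, h2, h3⟩ :=
                RichDescent.bad_mem μ hinv hfpf col hcol p (hW p hpW) hpbad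
              exact Finset.mem_biUnion.mpr ⟨(a, d), Finset.mem_product.mpr
                ⟨Finset.mem_range.mpr (by omega), Finset.mem_range.mpr (by omega)⟩,
                hB a d p hpW h1 h2 h3⟩
          _ ≤ ∑ x ∈ Finset.range (k + 2) ×ˢ Finset.range (k + 1), (B x.1 x.2).card :=
              Finset.card_biUnion_le
          _ ≤ ∑ _x ∈ Finset.range (k + 2) ×ˢ Finset.range (k + 1),
                ((k + 2) * M + (k + 2) ^ 2) :=
              Finset.sum_le_sum fun x hx => hsmall x.1 x.2 (by
                have h := (Finset.mem_product.mp hx).2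
                rw [Finset.mem_range] at h
                omega)
          _ = (k + 2) * (k + 1) * ((k + 2) * M + (k + 2) ^ 2) := by
              rw [Finset.sum_const, Finset.card_product, Finset.card_range, Finset.card_range,
                smul_eq_mul]
      have hsplit : (W.filter fun p => Function.Injective p).card +
          (W.filter fun p => ¬ Function.Injective p).card = W.card :=
        Finset.card_filter_add_card_filter_not _
      have hlog : 0 < Nat.log 2 (k + 2) := Nat.log_pos (by norm_num) (by omega)
      have hpow : (k + 2) ^ 2 ≤ (k + 2) ^ (2 * Nat.log 2 (k + 2)) :=
        Nat.pow_le_pow_right (by omega) (by omega)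
      exact RichDescent.count_good k M W.card _ _
        (le_trans (Nat.mul_le_mul_right _ hpow) hrich) hbad hsplit

end Summit.MatrixMultiplication.MatrixMultiplication.Theorems.HyperoctahedralThreshold
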